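import Summits.Ventures.PercRepro.Night2LocalD3ZeroClosure

/-!
# PercRepro — the regime `|E ∖ G| = 3` at `q = 4` on COLOOP-FREE flats: the fat-pair count and the cell (night-2, gen 12)

Sequel of `Night2LocalD3Zero.lean` / `Night2LocalD3ZeroClosure.lean`: the shadow sets `S` with at most ONE coloop.
A FAT pair through a non-coloop `t` of the six-element set `S` is a member `B = S ∖ {t, u}` carrying layer-2
weight with `G ∖ cl B = {t, u}`, so that every point `p ∈ G ∖ S` lies in `cl B`.  Four fat pairs through `t` put
such a `p` in the closure of at most one element of `S ∖ t` (independent) — impossible in a loopless simple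
matroid.  Hence at most `3` fat pairs through each non-coloop (`card_fat_through_le_three`), at most `9` (no
coloop of `S`) or `7` (one coloop) fat pairs in all (`two_mul_card_fat_le`), and with `w₂ ≤ 2/25` (fat) / `1/25`
(thin): `load₂ ≤ 24/25 ≤ 1 = cap₂` (no coloop), `load₂ ≤ 17/25 ≤ 19/25 ≤ cap₂` (one coloop) —
`load2_le_cap2_d3_zero_of_le_one`.  With `load2_le_cap2_d3_zero_of_two_le` this closes every shadow set
(`load2_le_cap2_d3_zero`): **`localShadowHall_d3_zero`** — the local form (LI_G) at every rank-`5` flat `G` with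
`|E ∖ G| = 3` whose restriction `M|G` is coloop-free, for loopless simple `M`.

Paper: `proofs/NIGHT-2-dq3.md` §1–§3.
-/

open scoped Matroid

namespace PercRepro.Shadow

open Finset PerFlat ThmH

variable {α : Type*} [DecidableEq α] {M : Matroid α} [M.Finite]

section FatCount

variable {G S : Finset α}

open scoped Classical in
/-- **At most three fat pairs through a non-coloop**: in a six-element shadow set `S` with `S ∖ t` independent,
at most `3` members `B` carrying layer-2 weight with `t ∉ B` have `|G ∖ cl B| = 2`. -/
theorem card_fat_through_le_three (hs : ∀ e ∈ gr M, ∀ f ∈ gr M, e ≠ f → rkN M {e, f} = 2)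
    (hl : ∀ e ∈ gr M, M.Indep {e}) (hG : G ∈ flatsQ M (4 + 1)) (hd : (gr M \ G).card = 3)
    (hS : S ∈ shadowAt M (4 + 2) 4 (Uq M (4 + 2) 4) G) (hS6 : S.card = 6) {t : α} (ht : t ∈ S)
    (htI : M.Indep ((S.erase t : Finset α) : Set α)) :
    ((ex2 M 4 G S).filter (fun B => t ∉ B ∧ (G \ clF M B).card = 2)).card ≤ 3 := by
  set F := (ex2 M 4 G S).filter (fun B => t ∉ B ∧ (G \ clF M B).card = 2) with hF
  set I := S.erase t with hI
  set J := I.filter (fun u => S \ {t, u} ∈ F) with hJ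
  have hSG : S ⊆ G := subset_of_mem_shadowAt hS
  -- every B ∈ F is S ∖ {t, u} for a unique u ∈ J
  have hBu : ∀ B ∈ F, ∃ u ∈ J, S \ B = {t, u} := by
    intro B hB
    have hB' := hB
    rw [hF, Finset.mem_filter] at hB'
    obtain ⟨hBex, htB, hfat⟩ := hB'
    obtain ⟨-, -, hBS, -, hcard⟩ := mem_ex2_unpack hBex
    have htSB : t ∈ S \ B := Finset.mem_sdiff.2 ⟨ht, htB⟩
    obtain ⟨u, huSB, hut⟩ : ∃ u ∈ S \ B, u ≠ t := by
      by_contra hno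
      push Not at hno
      have hsub1 : S \ B ⊆ {t} := fun x hx => Finset.mem_singleton.2 (hno x hx)
      have := Finset.card_le_card hsub1
      rw [Finset.card_singleton] at this
      omega
    have hpair : S \ B = {t, u} := by
      symm
      apply Finset.eq_of_subset_of_card_le
      · intro x hx
        rw [Finset.mem_insert, Finset.mem_singleton] at hx
        rcases hx with rfl | rfl
        · exact htSB
        · exact huSB
      · rw [hcard, Finset.card_pair (Ne.symm hut)]
    refine ⟨u, ?_, hpair⟩
    rw [hJ, Finset.mem_filter, hI, Finset.mem_erase]
    refine ⟨⟨hut, (Finset.mem_sdiff.1 huSB).1⟩, ?_⟩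
    rw [← hpair, Finset.sdiff_sdiff_eq_self hBS]
    exact hB
  -- F injects into J
  have hFJ : F.card ≤ J.card := by
    have hF' : F ⊆ J.image (fun u => S \ {t, u}) := by
      intro B hB
      obtain ⟨u, huJ, hpair⟩ := hBu B hB
      rw [Finset.mem_image]
      refine ⟨u, huJ, ?_⟩
      have hBS : B ⊆ S := by
        have := mem_ex2_unpack (Finset.mem_filter.1 (hF ▸ hB)).1
        exact this.2.2.1
      rw [← hpair, Finset.sdiff_sdiff_eq_self hBS]
    exact (Finset.card_le_card hF').trans Finset.card_image_le
  -- J has at most three elements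
  by_contra hlt
  push Not at hlt
  have hJ4 : 4 ≤ J.card := by omega
  have hJI : J ⊆ I := Finset.filter_subset _ _
  have hIc : I.card = 5 := by rw [hI, Finset.card_erase_of_mem ht, hS6]
  have hZc : (I \ J).card ≤ 1 := by
    have := Finset.card_sdiff_add_card_eq_card hJI
    omega
  obtain ⟨u₀, hu₀⟩ := Finset.card_pos.1 (by omega : 0 < J.card)
  have hu₀F : S \ {t, u₀} ∈ F := (Finset.mem_filter.1 hu₀).2
  have hu₀ex : S \ {t, u₀} ∈ ex2 M 4 G S := (Finset.mem_filter.1 hu₀F).1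
  obtain ⟨p, hpG, hpS⟩ := exists_mem_sdiff_of_mem_ex2 hG hd hS hu₀ex
  -- p lies in the closure of every B = S ∖ {t, u}, u ∈ J
  have hpcl : ∀ u ∈ J, p ∈ clF M (I.erase u) := by
    intro u hu
    have huF : S \ {t, u} ∈ F := (Finset.mem_filter.1 hu).2
    have huex : S \ {t, u} ∈ ex2 M 4 G S := (Finset.mem_filter.1 huF).1
    have hfat : (G \ clF M (S \ {t, u})).card = 2 := (Finset.mem_filter.1 huF).2.2
    obtain ⟨-, -, hBS, hsub, hcard⟩ := mem_ex2_unpack huex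
    have heq : G \ clF M (S \ {t, u}) = S \ (S \ {t, u}) :=
      (Finset.eq_of_subset_of_card_le hsub (by omega)).symm
    have hIu : I.erase u = S \ {t, u} := by
      ext x
      rw [hI, Finset.mem_erase, Finset.mem_erase, Finset.mem_sdiff, Finset.mem_insert, Finset.mem_singleton]
      tauto
    rw [hIu]
    by_contra hpcl'
    have hmem : p ∈ G \ clF M (S \ {t, u}) := Finset.mem_sdiff.2 ⟨hpG, hpcl'⟩
    rw [heq] at hmem
    exact hpS (Finset.mem_sdiff.1 hmem).1
  have hpI : p ∈ clF M I := clF_mono (Finset.erase_subset u₀ I) (hpcl u₀ hu₀)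
  have hpI' : p ∉ I := fun h => hpS (Finset.mem_of_mem_erase h)
  exact not_mem_clF_all_but_one hs hl htI hJI hZc hpI hpcl hpI'

open scoped Classical in
/-- Double counting: every member carrying layer-2 weight misses exactly two elements of `S`. -/
theorem two_mul_card_fat_eq (S : Finset α) (F : Finset (Finset α)) (hF : ∀ B ∈ F, (S \ B).card = 2) :
    2 * F.card = ∑ t ∈ S, (F.filter (fun B => t ∉ B)).card := by
  have h1 : ∀ t ∈ S, (F.filter (fun B => t ∉ B)).card = ∑ B ∈ F, (if t ∉ B then 1 else 0) := by
    intro t _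
    rw [Finset.card_filter]
  rw [Finset.sum_congr rfl h1, Finset.sum_comm]
  have h2 : ∀ B ∈ F, (∑ t ∈ S, (if t ∉ B then 1 else 0)) = 2 := by
    intro B hB
    rw [← Finset.card_filter, ← hF B hB]
    congr 1
    ext x
    simp only [Finset.mem_filter, Finset.mem_sdiff]
  rw [Finset.sum_congr rfl h2, Finset.sum_const, smul_eq_mul, mul_comm]

open scoped Classical in
/-- **The fat-pair count**: at a six-element shadow set with `a` coloops (`M|G` coloop-free), at most
`3 (6 − a)/2` members carrying layer-2 weight are fat. -/
theorem two_mul_card_fat_le (hs : ∀ e ∈ gr M, ∀ f ∈ gr M, e ≠ f → rkN M {e, f} = 2)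
    (hl : ∀ e ∈ gr M, M.Indep {e}) (hG : G ∈ flatsQ M (4 + 1)) (hd : (gr M \ G).card = 3)
    (hS : S ∈ shadowAt M (4 + 2) 4 (Uq M (4 + 2) 4) G) (hS6 : S.card = 6) :
    2 * ((ex2 M 4 G S).filter (fun B => (G \ clF M B).card = 2)).card ≤ 3 * (6 - (coloops M S).card) := by
  set F := (ex2 M 4 G S).filter (fun B => (G \ clF M B).card = 2) with hF
  have hF2 : ∀ B ∈ F, (S \ B).card = 2 := fun B hB => (mem_ex2_unpack (Finset.mem_filter.1 hB).1).2.2.2.2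
  rw [two_mul_card_fat_eq S F hF2]
  have hbound : ∀ t ∈ S, (F.filter (fun B => t ∉ B)).card ≤ if t ∈ coloops M S then 0 else 3 := by
    intro t ht
    split_ifs with htc
    · apply le_of_eq
      rw [Finset.card_eq_zero, Finset.filter_eq_empty_iff]
      intro B hB htB
      exact htB (mem_of_mem_ex2_of_mem_coloops hG hS (Finset.mem_filter.1 hB).1 htc)
    · have htI := indep_erase_of_not_coloop hG hS hS6 ht htc
      have h3 := card_fat_through_le_three hs hl hG hd hS hS6 ht htI
      refine le_trans (Finset.card_le_card ?_) h3
      intro B hB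
      rw [Finset.mem_filter] at hB ⊢
      rw [hF, Finset.mem_filter] at hB
      exact ⟨hB.1.1, hB.2, hB.1.2⟩
  refine (Finset.sum_le_sum hbound).trans ?_
  rw [Finset.sum_ite, Finset.sum_const, Finset.sum_const, smul_zero, zero_add, smul_eq_mul]
  have hcol : (S.filter (fun t => t ∈ coloops M S)) = coloops M S := by
    ext x
    rw [Finset.mem_filter]
    exact ⟨fun h => h.2, fun h => ⟨coloops_subset_self S h, h⟩⟩
  have hsplit := Finset.card_filter_add_card_filter_not (s := S) (fun t => t ∈ coloops M S)
  rw [hcol] at hsplit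
  rw [mul_comm]
  omega

open scoped Classical in
/-- **The column bound at `d = 3`, `q = 4`, no coloop of `M|G`, at most one coloop of `S`** (loopless simple
`M`): `load₂(S) ≤ cap₂(S)`. -/
theorem load2_le_cap2_d3_zero_of_le_one (hs : ∀ e ∈ gr M, ∀ f ∈ gr M, e ≠ f → rkN M {e, f} = 2)
    (hl : ∀ e ∈ gr M, M.Indep {e}) (hG : G ∈ flatsQ M (4 + 1)) (hd : (gr M \ G).card = 3)
    (hk : kColoops M G = 0) (hS : S ∈ shadowAt M (4 + 2) 4 (Uq M (4 + 2) 4) G)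
    (ha : (coloops M S).card ≤ 1) : load2 M 4 G S ≤ cap2 M 4 G S := by
  have hcap := cap2_ge_d3_zero hG hd hk S
  have hcap0 := cap2_nonneg_d3_zero hk S
  rcases Finset.eq_empty_or_nonempty (ex2 M 4 G S) with hemp | ⟨B₀, hB₀⟩
  · have hload := load2_le_card_ex2_mul (M := M) (q := 4) (G := G) (S := S) (c := 0)
      (fun B hB => by rw [hemp] at hB; exact absurd hB (Finset.notMem_empty B))
    rw [hemp, Finset.card_empty] at hload
    simp only [Nat.cast_zero, zero_mul] at hload
    exact hload.trans hcap0
  · have hS6 : S.card = 6 := card_eq_six_of_mem_ex2 hl hG hd hk hB₀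
    have hex := two_mul_card_ex2_le hG hS
    have hfat := two_mul_card_fat_le hs hl hG hd hS hS6
    set F := (ex2 M 4 G S).filter (fun B => (G \ clF M B).card = 2) with hF
    have hw : ∀ B ∈ ex2 M 4 G S,
        w2 M 4 G B S ≤ if (G \ clF M B).card = 2 then (2 : ℚ) / 25 else 1 / 25 := by
      intro B hB
      split_ifs with h2
      · exact w2_le_two_div_d3_zero hG hd hk hB
      · have hm : 2 ≤ (G \ clF M B).card := by
          obtain ⟨-, -, -, hsub, hcard⟩ := mem_ex2_unpack hB
          exact hcard ▸ Finset.card_le_card hsub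
        exact w2_le_one_div_d3_zero hG hd hk hB (by omega)
    have hload : load2 M 4 G S ≤
        ∑ B ∈ ex2 M 4 G S, (if (G \ clF M B).card = 2 then (2 : ℚ) / 25 else 1 / 25) := by
      unfold load2
      rw [← Finset.sum_filter_ne_zero]
      exact Finset.sum_le_sum (fun B hB => hw B hB)
    rw [Finset.sum_ite, Finset.sum_const, Finset.sum_const, nsmul_eq_mul, nsmul_eq_mul] at hload
    have hsplit := Finset.card_filter_add_card_filter_not (s := ex2 M 4 G S)
      (fun B => (G \ clF M B).card = 2)
    obtain ⟨a, ha'⟩ : ∃ a, (coloops M S).card = a := ⟨_, rfl⟩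
    rw [ha'] at hex hcap ha hfat
    have hFq : ((ex2 M 4 G S).filter (fun B => (G \ clF M B).card = 2)).card = F.card := rfl
    have hTq : ((ex2 M 4 G S).filter (fun B => ¬ (G \ clF M B).card = 2)).card =
        (ex2 M 4 G S).card - F.card := by omega
    rw [hFq, hTq] at hload
    have hFle : F.card ≤ (ex2 M 4 G S).card := by omega
    have hFq' : (F.card : ℚ) ≤ ((ex2 M 4 G S).card : ℚ) := by exact_mod_cast hFle
    have hcast : (((ex2 M 4 G S).card - F.card : ℕ) : ℚ) = ((ex2 M 4 G S).card : ℚ) - (F.card : ℚ) := by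
      rw [Nat.cast_sub hFle]
    rw [hcast] at hload
    interval_cases a
    · -- no coloop of `S`: `#ex2 ≤ 15`, `#F ≤ 9`
      have he : (ex2 M 4 G S).card ≤ 15 := by omega
      have hf : F.card ≤ 9 := by omega
      have he' : ((ex2 M 4 G S).card : ℚ) ≤ 15 := by exact_mod_cast he
      have hf' : (F.card : ℚ) ≤ 9 := by exact_mod_cast hf
      norm_num at hcap
      nlinarith
    · -- one coloop of `S`: `#ex2 ≤ 10`, `#F ≤ 7`
      have he : (ex2 M 4 G S).card ≤ 10 := by omega
      have hf : F.card ≤ 7 := by omega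
      have he' : ((ex2 M 4 G S).card : ℚ) ≤ 10 := by exact_mod_cast he
      have hf' : (F.card : ℚ) ≤ 7 := by exact_mod_cast hf
      norm_num at hcap
      nlinarith

open scoped Classical in
/-- **The column bound at `d = 3`, `q = 4` on coloop-free flats** (loopless simple `M`), every shadow set. -/
theorem load2_le_cap2_d3_zero (hs : ∀ e ∈ gr M, ∀ f ∈ gr M, e ≠ f → rkN M {e, f} = 2)
    (hl : ∀ e ∈ gr M, M.Indep {e}) (hG : G ∈ flatsQ M (4 + 1)) (hd : (gr M \ G).card = 3)
    (hk : kColoops M G = 0) (hS : S ∈ shadowAt M (4 + 2) 4 (Uq M (4 + 2) 4) G) :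
    load2 M 4 G S ≤ cap2 M 4 G S := by
  rcases Nat.lt_or_ge (coloops M S).card 2 with h | h
  · exact load2_le_cap2_d3_zero_of_le_one hs hl hG hd hk hS (by omega)
  · exact load2_le_cap2_d3_zero_of_two_le hs hG hd hk hS h

/-- **THE COLOOP-FREE CELL OF THE REGIME `|E ∖ G| = 3` AT `q = 4`**: the local form (LI_G) holds at every
rank-`5` flat `G` with `|E ∖ G| = 3` whose restriction `M|G` has no coloop, for a loopless simple matroid —
by the distance-2 rule. -/
theorem localShadowHall_d3_zero (hs : ∀ e ∈ gr M, ∀ f ∈ gr M, e ≠ f → rkN M {e, f} = 2)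
    (hl : ∀ e ∈ gr M, M.Indep {e}) (hG : G ∈ flatsQ M (4 + 1)) (hd : (gr M \ G).card = 3)
    (hk : kColoops M G = 0) : LocalShadowHall M 4 G := by
  classical
  apply localShadowHall_of_distance_two hG (by omega)
  intro S hS
  exact load2_le_cap2_d3_zero hs hl hG hd hk hS

end FatCount

end PercRepro.Shadow
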